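import Literature.MathematicalPhysics.QuantumLattice.FinDimSpectrumClusterGapProofs
import Literature.MathematicalPhysics.QuantumLattice.OverlapIndexTrace
import Literature.MathematicalPhysics.QuantumLattice.WilsonDiracLowerBound
import HarnessLib

/-!
# Stability of the overlap index under gauge-field deformations (no level crossing)

Proof file (theorems only, no definitions, no named facts) in the story of
`Literature/MathematicalPhysics/QuantumLattice/AbelianFluxSectors.lean` (`IOSFluxSectorIndex`) and
`OverlapIndexTrace.lean` / `OverlapIndexTheorem.lean`: the index of Neuberger's overlap operator,
`index D = N₋(H) − ½ dim` with `H = Γ₅ D_W(U, −m₀, 1)` the Hermitian Wilson–Dirac kernel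
(`overlap_index_eq_countP_neg_sub_half`), is **locally constant on the set of admissible gauge
fields**: Neuberger's bound `H² ≥ m₀² − 30δ` (`wilsonDirac_normSq_mulVec_ge_of_plaquette`,
`‖1 − ρ(P)‖ ≤ δ` on all plaquettes) keeps the spectrum of `H` away from `0`, and by Weyl's
perturbation theorem the number `N₋(H)` of negative eigenvalues cannot change under a perturbation
of `H` of operator norm smaller than the gap. Consequently the index is constant along every
continuous path of admissible fields — the statement "the index `n₊ − n₋` is a topological
invariant which assumes a fixed value in each magnetic flux sector" of Lüscher,
Nucl. Phys. B 549 (1999) 295, §3.2 [Luscher1999AbelianChiral], in the form used by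
Igarashi–Okuyama–Suzuki (arXiv:hep-lat/0206003, §2, index (2.3) on admissible fields (2.1)).

Contents:

* `sq_le_eigenvalues_sq_of_normSq_mulVec_ge` — a quadratic lower bound `c Σ‖vᵢ‖² ≤ Σ‖(A v)ᵢ‖²`
  forces `c ≤ λᵢ²` for every eigenvalue of a Hermitian `A`;
* `card_eigenvalues_neg_eq_of_norm_sub_le` — **Weyl stability of the negative count**: if all
  `|λᵢ(A)| ≥ g` and `‖A − B‖ ≤ t < g` (L²-operator norm) then `#{λᵢ(B) < 0} = #{λᵢ(A) < 0}` and all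
  `|λᵢ(B)| ≥ g − t` (a corollary of `sepCount_of_norm_sub_le`, Bhatia *Matrix Analysis*
  Cor. III.2.6);
* `det_ne_zero_of_abs_eigenvalues_pos`, `countP_neg_roots_charpoly_eq_of_norm_sub_le` — the same
  through `det` and through the roots of the characteristic polynomial (the form in which
  `IOSFluxSectorIndex` counts `N₋`);
* `normSq_overlapKernel_mulVec_ge` — Neuberger's gap for the Hermitian kernel
  `H = Γ₅ D_W`: `(m₀² − 30δ) Σ‖vᵢ‖² ≤ Σ‖(H v)ᵢ‖²`;
* `countP_neg_overlapKernel_eq_of_norm_sub_le` — **no level crossing**: for an admissible `U`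
  (`‖1 − ρ(P)‖ ≤ δ`, `30δ < m₀²`, `m₀ ≤ 1`) and any `U'` with `‖H(U) − H(U')‖ ≤ t`,
  `t² < m₀² − 30δ`, `N₋(H(U')) = N₋(H(U))`;
* `countP_neg_overlapKernel_eq_of_continuous` — **the index is constant along continuous
  admissible deformations** (parameter space any preconnected space).

## References

* M. Lüscher, *Abelian chiral gauge theories on the lattice with exact gauge invariance*,
  Nucl. Phys. B 549 (1999) 295–334, arXiv:hep-lat/9811032, §3.2. [Luscher1999AbelianChiral]
* H. Igarashi, K. Okuyama, H. Suzuki, *More about the axial anomaly on the lattice*,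
  Nucl. Phys. B 644 (2002) 383, arXiv:hep-lat/0206003, §2 (2.1)–(2.3). [IgarashiOkuyamaSuzuki2002]
* H. Neuberger, Phys. Rev. D 61 (2000) 085015, arXiv:hep-lat/9911004 (the bound `H² ≥ m₀² − 30δ`).
  [Neuberger2000Bounds]
* R. Bhatia, *Matrix Analysis*, GTM 169, Springer (1997), Cor. III.2.6 (Weyl). [folklore]
-/

noncomputable section

open Matrix Finset
open scoped InnerProductSpace
open Literature.Probability.LatticeModels (TorusSite)
open Literature.MathematicalPhysics.QuantumFieldTheory

namespace Literature.MathematicalPhysics.QuantumLattice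

/-! ### Matrix level: a spectral gap survives a small Hermitian perturbation -/

section MatrixLevel

variable {n : Type*} [Fintype n] [DecidableEq n]

/-- A quadratic lower bound `c Σᵢ ‖vᵢ‖² ≤ Σᵢ ‖(A v)ᵢ‖²` for all `v` forces `c ≤ λᵢ²` for every
eigenvalue `λᵢ` of the Hermitian matrix `A` (test on the unit eigenvector `uᵢ`, `A uᵢ = λᵢ uᵢ`).
[folklore] -/
theorem sq_le_eigenvalues_sq_of_normSq_mulVec_ge {A : Matrix n n ℂ} (hA : A.IsHermitian) {c : ℝ}
    (h : ∀ v : n → ℂ, c * ∑ i, ‖v i‖ ^ 2 ≤ ∑ i, ‖(A *ᵥ v) i‖ ^ 2) (i : n) :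
    c ≤ hA.eigenvalues i ^ 2 := by
  set u : EuclideanSpace ℂ n := hA.eigenvectorBasis i with hu
  have hunit : ∑ j, ‖u j‖ ^ 2 = 1 := by
    rw [← EuclideanSpace.norm_sq_eq, hu, hA.eigenvectorBasis.orthonormal.1 i, one_pow]
  have hAu : A *ᵥ ⇑u = hA.eigenvalues i • ⇑u := hA.mulVec_eigenvectorBasis i
  have h1 := h u
  rw [hAu, hunit, mul_one] at h1
  calc c ≤ ∑ j, ‖(hA.eigenvalues i • ⇑u) j‖ ^ 2 := h1
    _ = hA.eigenvalues i ^ 2 * ∑ j, ‖u j‖ ^ 2 := by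
        rw [Finset.mul_sum]
        refine Finset.sum_congr rfl fun j _ => ?_
        rw [Pi.smul_apply, norm_smul, mul_pow, Real.norm_eq_abs, sq_abs]
    _ = hA.eigenvalues i ^ 2 := by rw [hunit, mul_one]

/-- From `c ≤ λᵢ²` to `√c ≤ |λᵢ|`. [folklore] -/
theorem sqrt_le_abs_eigenvalues_of_normSq_mulVec_ge {A : Matrix n n ℂ} (hA : A.IsHermitian)
    {c : ℝ} (h : ∀ v : n → ℂ, c * ∑ i, ‖v i‖ ^ 2 ≤ ∑ i, ‖(A *ᵥ v) i‖ ^ 2) (i : n) :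
    Real.sqrt c ≤ |hA.eigenvalues i| := by
  rw [← Real.sqrt_sq_eq_abs]
  exact Real.sqrt_le_sqrt (sq_le_eigenvalues_sq_of_normSq_mulVec_ge hA h i)

variable {𝕜 : Type*} [RCLike 𝕜]

/-- **Weyl stability of the negative eigenvalue count.** Let `A`, `B` be Hermitian with all
`|λᵢ(A)| ≥ g` and `‖A − B‖ ≤ t < g` (L²-operator norm, written through `toEuclideanCLM`). Then
`B` has exactly as many negative eigenvalues as `A`, and all `|λᵢ(B)| ≥ g − t`: the `#{λᵢ(A) < 0}`
eigenvalues `≤ −g` of `A` are separated by the gap `2g > 2t` from the others, so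
`sepCount_of_norm_sub_le` (Weyl's perturbation theorem, Bhatia Cor. III.2.6) applies with
`e = −g`. [folklore] -/
theorem card_eigenvalues_neg_eq_of_norm_sub_le {A B : Matrix n n 𝕜} (hA : A.IsHermitian)
    (hB : B.IsHermitian) {g t : ℝ} (hgap : ∀ i, g ≤ |hA.eigenvalues i|)
    (hnorm : ‖toEuclideanCLM (n := n) (𝕜 := 𝕜) (A - B)‖ ≤ t) (ht : t < g) :
    #{i | hB.eigenvalues i < 0} = #{i | hA.eigenvalues i < 0} ∧
      ∀ i, g - t ≤ |hB.eigenvalues i| := by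
  have ht0 : 0 ≤ t := (norm_nonneg _).trans hnorm
  have hg : 0 < g := by linarith
  have hsep : ∀ i, hA.eigenvalues i ≤ -g ∨ -g + 2 * g ≤ hA.eigenvalues i := fun i => by
    rcases le_abs'.mp (hgap i) with h | h
    · exact Or.inl h
    · exact Or.inr (by linarith)
  obtain ⟨hcount, hsepB⟩ := sepCount_of_norm_sub_le hA hB (e := -g) (g := 2 * g)
    (m := #{i | hA.eigenvalues i ≤ -g}) hnorm rfl hsep (by linarith)
  have hA' : #{i | hA.eigenvalues i ≤ -g} = #{i | hA.eigenvalues i < 0} := by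
    congr 1
    ext i
    simp only [mem_filter, mem_univ, true_and]
    refine ⟨fun h => by linarith, fun h => ?_⟩
    rcases hsep i with h' | h'
    · exact h'
    · linarith
  have hB' : #{i | hB.eigenvalues i ≤ -g + t} = #{i | hB.eigenvalues i < 0} := by
    congr 1
    ext i
    simp only [mem_filter, mem_univ, true_and]
    refine ⟨fun h => by linarith, fun h => ?_⟩
    rcases hsepB i with h' | h'
    · exact h'
    · linarith
  refine ⟨by rw [← hB', hcount, hA'], fun i => ?_⟩
  rcases hsepB i with h | h
  · exact le_abs'.mpr (Or.inl (by linarith))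
  · exact le_abs'.mpr (Or.inr (by linarith))

/-- A Hermitian matrix all of whose eigenvalues are bounded away from zero is invertible.
[folklore] -/
theorem det_ne_zero_of_abs_eigenvalues_pos {A : Matrix n n 𝕜} (hA : A.IsHermitian) {g : ℝ}
    (hg : 0 < g) (hgap : ∀ i, g ≤ |hA.eigenvalues i|) : A.det ≠ 0 := by
  rw [hA.det_eq_prod_eigenvalues, Finset.prod_ne_zero_iff]
  intro i _
  have : hA.eigenvalues i ≠ 0 := fun h0 => by
    have := hgap i
    rw [h0, abs_zero] at this
    linarith
  exact_mod_cast this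

/-- **Weyl stability of `N₋`, characteristic-polynomial form.** Under the hypotheses of
`card_eigenvalues_neg_eq_of_norm_sub_le` (all `|λᵢ(A)| ≥ g`, `‖A − B‖ ≤ t < g`), `A` and `B` have
the same number of roots of the characteristic polynomial in the open left half-plane, and
`det B ≠ 0`. [folklore] -/
theorem countP_neg_roots_charpoly_eq_of_norm_sub_le {A B : Matrix n n ℂ} (hA : A.IsHermitian)
    (hB : B.IsHermitian) {g t : ℝ} (hgap : ∀ i, g ≤ |hA.eigenvalues i|)
    (hnorm : ‖toEuclideanCLM (n := n) (𝕜 := ℂ) (A - B)‖ ≤ t) (ht : t < g) :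
    B.charpoly.roots.countP (fun z => z.re < 0) = A.charpoly.roots.countP (fun z => z.re < 0) ∧
      B.det ≠ 0 := by
  obtain ⟨hcard, hgapB⟩ := card_eigenvalues_neg_eq_of_norm_sub_le hA hB hgap hnorm ht
  refine ⟨?_, det_ne_zero_of_abs_eigenvalues_pos hB (sub_pos.mpr ht) hgapB⟩
  rw [countP_neg_roots_charpoly_eq_card_neg_eigenvalues hA,
    countP_neg_roots_charpoly_eq_card_neg_eigenvalues hB]
  exact hcard

end MatrixLevel

/-! ### The Hermitian Wilson–Dirac kernel: Neuberger's gap and no level crossing -/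

section Overlap

open scoped Matrix.Norms.L2Operator

variable {L N : ℕ} [NeZero L] {G : Type*} [Group G] (ρ : G →* Matrix (Fin N) (Fin N) ℂ)

/-- `Γ₅` acts by signs in the chiral basis, so `H = Γ₅ D_W` and `D_W` have the same pointwise
norms: `‖(H v)_p‖ = ‖(D_W v)_p‖`. [folklore] -/
theorem norm_overlapKernel_mulVec_apply (U : GaugeConfig 4 L G) (m₀ : ℝ)
    (v : TorusSite 4 L × Fin N × Fin 4 → ℂ) (p : TorusSite 4 L × Fin N × Fin 4) :
    ‖(overlapKernel ρ U m₀ *ᵥ v) p‖ = ‖(wilsonDirac ρ U (-m₀) 1 *ᵥ v) p‖ := by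
  rw [overlapKernel, ← mulVec_mulVec, spinorLift_gammaFive_eq_diagonal, mulVec_diagonal, norm_mul]
  obtain ⟨x, a, s⟩ := p
  fin_cases s <;> simp

/-- **Neuberger's gap for the Hermitian kernel.** If `‖1 − ρ(P)‖ ≤ δ` on every plaquette and
`m₀ ≤ 1`, then `(m₀² − 30δ) Σ‖v_p‖² ≤ Σ‖(H v)_p‖²` for `H = Γ₅ D_W(U, −m₀, 1)`.
[cite: Neuberger2000Bounds, §Lower bound] -/
theorem normSq_overlapKernel_mulVec_ge (hρ : ∀ g, ρ g ∈ Matrix.unitaryGroup (Fin N) ℂ)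
    (U : GaugeConfig 4 L G) {m₀ : ℝ} (hm : m₀ ≤ 1) {δ : ℝ} (hδ : 0 ≤ δ)
    (hU : ∀ (y : TorusSite 4 L) (μ ν : Fin 4), μ ≠ ν →
      ‖(1 : Matrix (Fin N) (Fin N) ℂ) - ρ (plaquetteHolonomy U y μ ν)‖ ≤ δ)
    (v : TorusSite 4 L × Fin N × Fin 4 → ℂ) :
    (m₀ ^ 2 - 30 * δ) * ∑ p, ‖v p‖ ^ 2 ≤ ∑ p, ‖(overlapKernel ρ U m₀ *ᵥ v) p‖ ^ 2 := by
  have h := wilsonDirac_normSq_mulVec_ge_of_plaquette ρ hρ U (-m₀) (by linarith) δ hδ hU v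
  simp only [norm_overlapKernel_mulVec_apply]
  simpa [neg_sq] using h

/-- The spectral gap of `H(U)` for an admissible field: `√(m₀² − 30δ) ≤ |λᵢ(H(U))|`.
[cite: Neuberger2000Bounds, §Lower bound] -/
theorem sqrt_le_abs_eigenvalues_overlapKernel (hρ : ∀ g, ρ g ∈ Matrix.unitaryGroup (Fin N) ℂ)
    (U : GaugeConfig 4 L G) {m₀ : ℝ} (hm : m₀ ≤ 1) {δ : ℝ} (hδ : 0 ≤ δ)
    (hU : ∀ (y : TorusSite 4 L) (μ ν : Fin 4), μ ≠ ν →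
      ‖(1 : Matrix (Fin N) (Fin N) ℂ) - ρ (plaquetteHolonomy U y μ ν)‖ ≤ δ) (i) :
    Real.sqrt (m₀ ^ 2 - 30 * δ) ≤ |(overlapKernel_isHermitian ρ hρ U m₀).eigenvalues i| :=
  sqrt_le_abs_eigenvalues_of_normSq_mulVec_ge _ (normSq_overlapKernel_mulVec_ge ρ hρ U hm hδ hU) i

/-- **No level crossing.** Let `U` be admissible (`‖1 − ρ(P)‖ ≤ δ` on all plaquettes,
`m₀ ≤ 1`) and let `U'` be any gauge field with `‖H(U) − H(U')‖ ≤ t` (L²-operator norm of the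
Hermitian kernels, `Matrix.Norms.L2Operator`) where `t < √(m₀² − 30δ)`. Then `H(U')` has exactly as many negative eigenvalues
as `H(U)` (counted as roots of the characteristic polynomial) and `det H(U') ≠ 0`; in particular
the overlap index `N₋ − ½ dim` (`overlap_index_eq_countP_neg_sub_half`) is the same for `U` and
`U'`. [cite: Luscher1999AbelianChiral, §3.2; IgarashiOkuyamaSuzuki2002, §2 (2.1)–(2.3)] -/
theorem countP_neg_overlapKernel_eq_of_norm_sub_le
    (hρ : ∀ g, ρ g ∈ Matrix.unitaryGroup (Fin N) ℂ) (U U' : GaugeConfig 4 L G) {m₀ : ℝ}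
    (hm : m₀ ≤ 1) {δ : ℝ} (hδ : 0 ≤ δ)
    (hU : ∀ (y : TorusSite 4 L) (μ ν : Fin 4), μ ≠ ν →
      ‖(1 : Matrix (Fin N) (Fin N) ℂ) - ρ (plaquetteHolonomy U y μ ν)‖ ≤ δ)
    {t : ℝ} (hnorm : ‖overlapKernel ρ U m₀ - overlapKernel ρ U' m₀‖ ≤ t)
    (ht : t < Real.sqrt (m₀ ^ 2 - 30 * δ)) :
    (overlapKernel ρ U' m₀).charpoly.roots.countP (fun z => z.re < 0) =
        (overlapKernel ρ U m₀).charpoly.roots.countP (fun z => z.re < 0) ∧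
      (overlapKernel ρ U' m₀).det ≠ 0 :=
  countP_neg_roots_charpoly_eq_of_norm_sub_le (overlapKernel_isHermitian ρ hρ U m₀)
    (overlapKernel_isHermitian ρ hρ U' m₀) (sqrt_le_abs_eigenvalues_overlapKernel ρ hρ U hm hδ hU)
    (by rw [Matrix.l2_opNorm_toEuclideanCLM]; exact hnorm) ht

/-- **The overlap index is constant along continuous admissible deformations.** Let `X` be a
preconnected parameter space and `s ↦ U_s` a family of gauge fields, all admissible
(`‖1 − ρ(P(U_s))‖ ≤ δ`, `30δ < m₀²`, `m₀ ≤ 1`), such that the Hermitian kernel `s ↦ H(U_s)`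
is continuous in operator norm. Then `N₋(H(U_s))` — hence the overlap index
`N₋ − ½ dim` — does not depend on `s`: it is locally constant by
`countP_neg_overlapKernel_eq_of_norm_sub_le`, and a locally constant function on a preconnected
space is constant. This is the precise content of "the index `n₊ − n₋` is a topological
invariant which assumes a fixed value in each magnetic flux sector".
[cite: Luscher1999AbelianChiral, §3.2; IgarashiOkuyamaSuzuki2002, §2] -/
theorem countP_neg_overlapKernel_eq_of_continuous {X : Type*} [TopologicalSpace X]
    [PreconnectedSpace X] (hρ : ∀ g, ρ g ∈ Matrix.unitaryGroup (Fin N) ℂ)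
    (U : X → GaugeConfig 4 L G) {m₀ : ℝ} (hm : m₀ ≤ 1) {δ : ℝ} (hδ : 0 ≤ δ)
    (hgap : 30 * δ < m₀ ^ 2)
    (hU : ∀ (s : X) (y : TorusSite 4 L) (μ ν : Fin 4), μ ≠ ν →
      ‖(1 : Matrix (Fin N) (Fin N) ℂ) - ρ (plaquetteHolonomy (U s) y μ ν)‖ ≤ δ)
    (hcont : Continuous fun s => overlapKernel ρ (U s) m₀) (s s' : X) :
    (overlapKernel ρ (U s) m₀).charpoly.roots.countP (fun z => z.re < 0) =
      (overlapKernel ρ (U s') m₀).charpoly.roots.countP (fun z => z.re < 0) := by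
  set f : X → ℕ := fun s => (overlapKernel ρ (U s) m₀).charpoly.roots.countP (fun z => z.re < 0)
    with hf
  have hg : 0 < Real.sqrt (m₀ ^ 2 - 30 * δ) := Real.sqrt_pos.mpr (by linarith)
  have hloc : IsLocallyConstant f := by
    rw [IsLocallyConstant.iff_eventually_eq]
    intro s₀
    have hball : Metric.ball (overlapKernel ρ (U s₀) m₀) (Real.sqrt (m₀ ^ 2 - 30 * δ) / 2) ∈
        nhds (overlapKernel ρ (U s₀) m₀) := Metric.ball_mem_nhds _ (half_pos hg)
    filter_upwards [hcont.continuousAt.preimage_mem_nhds hball] with s hs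
    rw [Set.mem_preimage, Metric.mem_ball, dist_eq_norm] at hs
    have hs' : ‖overlapKernel ρ (U s₀) m₀ - overlapKernel ρ (U s) m₀‖ ≤
        Real.sqrt (m₀ ^ 2 - 30 * δ) / 2 := by
      rw [← norm_neg, neg_sub]
      exact hs.le
    exact (countP_neg_overlapKernel_eq_of_norm_sub_le ρ hρ (U s₀) (U s) hm hδ (hU s₀) hs'
      (by linarith)).1
  exact hloc.apply_eq_of_preconnectedSpace s s'

end Overlap

end Literature.MathematicalPhysics.QuantumLattice
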